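import Summits.Ventures.HodgeKum4.Theses.KummerFixedLocus
import Summits.Ventures.HodgeKum4.Theorems.LaneVDefs
import Summits.Ventures.HodgeKum4.Theorems.KummerFixedLocusL1HilbDefs
import Summits.Ventures.HodgeKum4.Theorems.KummerFixedLocusL1HilbCert
import Summits.Ventures.HodgeKum4.Theorems.KummerFixedLocusL1HilbEval
import Summits.Ventures.HodgeKum4.Theorems.KummerFixedLocusL1HilbSuperLie
import Summits.Ventures.HodgeKum4.Theorems.KummerFixedLocusL1HilbLehnSuper
import Summits.Ventures.HodgeKum4.Theorems.KummerFixedLocusL1HilbModel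
import Literature.AlgebraicGeometry.HilbertScheme.LefschetzDualTransfer
import Literature.AlgebraicGeometry.HilbertScheme.LefschetzDualHilbertScheme
import Literature.AlgebraicGeometry.HilbertScheme.TransferOperatorSuperCommutators
import HarnessLib

/-!
# SKELETON v2p5 (prover hodge-kum4-p5) for item stmt-Ventures-20306 (W-form): `LefschetzGenerationHilb n` for every `n` ⇒ `LefschetzGenerationHilbW 5` — the V2 mechanism, re-cut

Line `v2p5` for crux stmt-Ventures-20306 (`…Theses.KummerFixedLocus.LefschetzGenerationHilb5 = LefschetzGenerationHilbW 5`, the W-form; the line proves the STRONGER ∀-instance form `LefschetzGenerationHilb n` for all `n` and applies `lefschetzGenerationHilbW_of_hilb`).  Definitions in the tree module `…Theorems.KummerFixedLocusL1HilbDefs`; stubs S-A/S-D/S-E are LANDED (`…L1HilbSuperLie`, `…L1HilbCert`, `…L1HilbEval`) and restated here by `exact`; S-B and S-C are LANDED too (`…L1HilbLehnSuper`, `…L1HilbModel`); only S-F `stub_span` is `sorry` (p1 g5 + p2 g12 halves, plan g19 seam `SF.stub_span_of_halves`).  Re-cut of the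
planner's `v2line.lean` (stub_full / stub_units / stub_polarise) into SIX stubs whose interfaces are concrete Lean
objects (no `IsSuperTraceless`, no quantification over all supertraceless `φ`):

* `stub_superLie`   (S-A) super-version of Oberdieck Cor. 3.5: `[T_t(φ), T_{t'}(ψ)} = T_{t+t'}([φ,ψ})` for graded
                     `φ, ψ` of ANY integer degrees (odd allowed) and an even Casimir tensor.
* `stub_lehnSuper`  (S-B) Lehn/LQW `𝔊₀(y) = T₁(m_y)` for homogeneous `y` of ANY degree (odd allowed).
* `stub_model`      (S-C) transport: a basis `b : Fin 16 → H*(A)` (`b 0 = 1`, `b I ∈ H^{|I|}`) in which left cup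
                     product by `b I` is the integer matrix `mulMat I` of `Λ*ℤ⁴` and `Λ_A` is the matrix `lamMat`
                     (symplectic basis adapted to `α`, `α ∧ α ≠ 0` from the `𝔰𝔩₂`-relations, partner uniqueness).
* `stub_cert`       (S-D) the loop-superalgebra certificate (S2) as KERNEL identities of sparse `16 × 16` integer
                     matrices (a re-typing of `Literature.Computation.AbelianHilbFock.LieCertificate`, which is a
                     `native_decide`d `Bool` and not consumable).
* `stub_eval`       (S-E) loop-algebra evaluation + Vandermonde: the stabiliser algebra of `W` contains every
                     single-weight number operator `τ_k(id)|ₙ` and polarisation `τ_k(b I ⊗ b₀^∨)|ₙ`, `k ≤ n`.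
* `stub_span`       (S-F) shape projectors, unit monomials by Lehn's joins (`boundary_bracket`), polarisation,
                     Nakajima–Grojnowski cyclicity: such a `W ∋ 1` that is `𝔡`-stable is all of `H*(A^[n])`.

Composition `lefschetzGenerationHilb_of_stubs : ∀ n, LefschetzGenerationHilb n` and the crux BY NAME
`LefschetzGenerationHilb5_of`.  Nothing here asserts L1-Hilb / L1 / HC_Kum4Type: the stubs are `sorry`.
-/

noncomputable section

open CategoryTheory DirectSum
open scoped TensorProduct
open Literature.AlgebraicTopology.SingularHomology
open Literature.AlgebraicGeometry Literature.AlgebraicGeometry.Hyperkaehler Literature.AlgebraicGeometry.HilbertScheme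
open Literature.AlgebraicGeometry.HodgeTheory (complexBetti)
open Literature.AlgebraicGeometry.Motives (AbelianVariety ComplexPoints SchemeOver IsSmoothProjective)

namespace Summit.Ventures.HodgeKum4.Cruxes.LefschetzGenerationHilb5.V2p5

open Summit.Ventures.HodgeKum4 Summit.Ventures.HodgeKum4.L1Hilb

variable {S : SchemeOver ℂ} {hS : IsSmoothProjective 2 S} {H : HilbertSchemesOfPoints S}

/-! ### The six stubs -/

/-- (S-A) **Super Oberdieck Cor. 3.5.**  For graded endomorphisms `φ`, `ψ` of `H*(S)` of integer degrees `d`, `d'`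
(any parity), an even Casimir tensor `C` and `t, t' ∈ ℤ`: `[T_t(φ), T_{t'}(ψ)} = T_{t+t'}([φ, ψ})` with the signs
`(−1)^{|d||d'|}`. -/
theorem stub_superLie (𝔑 : NakajimaOperators hS H)
    {C : totalCohomology ℂ (ComplexPoints S) ⊗[ℂ] totalCohomology ℂ (ComplexPoints S)}
    (hCg : C ∈ evenTensorSpan ℂ (coeffFamily S)) (hC : IsCasimir ℂ (poincarePairing hS) C) (t t' : ℤ)
    {φ ψ : Module.End ℂ (totalCohomology ℂ (ComplexPoints S))} {d d' : ℤ}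
    (hφ : IsOfDegree ℂ (ComplexPoints S) φ d) (hψ : IsOfDegree ℂ (ComplexPoints S) ψ d') :
    superBracket ℂ (transferOp ℂ 𝔑.q C t φ) (transferOp ℂ 𝔑.q C t' ψ) d.natAbs d'.natAbs =
      transferOp ℂ 𝔑.q C (t + t') (superBracket ℂ φ ψ d.natAbs d'.natAbs) :=
  L1Hilb.stub_superLie 𝔑 hCg hC t t' hφ hψ

/-- (S-B) **Lehn's formula `𝔊₀(y) = T₁(m_y)` for homogeneous `y` of any degree** (odd allowed), even Casimir. -/
theorem stub_lehnSuper (𝔊 : ChernCharacterOperators hS H)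
    {C : totalCohomology ℂ (ComplexPoints S) ⊗[ℂ] totalCohomology ℂ (ComplexPoints S)}
    (hCg : C ∈ evenTensorSpan ℂ (coeffFamily S)) (hC : IsCasimir ℂ (poincarePairing hS) C) (s : ℕ)
    (y : complexBetti S s) :
    𝔊.cupOperator 0 (ofDegree ℂ (ComplexPoints S) s y) =
      transferOp ℂ 𝔊.q C 1 (totalCup ℂ (ComplexPoints S) (ofDegree ℂ (ComplexPoints S) s y)) :=
  L1Hilb.stub_lehnSuper 𝔊 hCg hC s y

/-- (S-C) **Model transport.**  For an abelian surface and `α ∈ H²` with a dual Lefschetz operator `Λ_A` there is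
a basis `b` of `H*(A(ℂ); ℂ)` indexed by bitmasks with `b 0 = 1`, `b I ∈ H^{|I|}`, left cup product by `b I` given by
the integer matrix `mulMat I`, and `Λ_A` given by `lamMat`. -/
theorem stub_model {A : AbelianVariety ℂ} (hA : A.dim = 2) (α : complexBetti A.X 2)
    (Λ_A : Module.End ℂ (totalCohomology ℂ (ComplexPoints A.X))) (hΛ : IsDualLefschetz 2 α Λ_A) :
    ∃ b : Module.Basis (Fin 16) ℂ (totalCohomology ℂ (ComplexPoints A.X)),
      b 0 = unitCoeff A.X ∧ (∀ I, b I ∈ LinearMap.range (ofDegree ℂ (ComplexPoints A.X) (deg4 I))) ∧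
      (∀ I, Matrix.toLin b b ((mulMat I).map (Int.castRingHom ℂ)) = totalCup ℂ (ComplexPoints A.X) (b I)) ∧
      Matrix.toLin b b (lamMat.map (Int.castRingHom ℂ)) = Λ_A :=
  L1Hilb.stub_model hA α Λ_A hΛ

/-- (S-D) **The loop-superalgebra certificate** (kernel form). -/
theorem stub_cert : LieCert :=
  L1Hilb.stub_cert

/-- (S-E) **Evaluation is full** (loop algebra of `{T₁(m_{bI})}_{1≤|I|≤3} ∪ {T₋₁(Λ)}` + Vandermonde): a subspace
`W ⊆ H*(S^[n])` stable under these operators' blocks is stable under every single-weight number operator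
`τ_k(id)|ₙ` and polarisation `τ_k(b I ⊗ b₀^∨)|ₙ`, `1 ≤ k ≤ n`, `I ≠ 0`. -/
theorem stub_eval (hcert : LieCert) (𝔑 : NakajimaOperators hS H)
    {C : totalCohomology ℂ (ComplexPoints S) ⊗[ℂ] totalCohomology ℂ (ComplexPoints S)}
    (hCg : C ∈ evenTensorSpan ℂ (coeffFamily S)) (hC : IsCasimir ℂ (poincarePairing hS) C)
    (hLie : ∀ (t t' : ℤ) (φ ψ : Module.End ℂ (totalCohomology ℂ (ComplexPoints S))) (d d' : ℤ),
      IsOfDegree ℂ (ComplexPoints S) φ d → IsOfDegree ℂ (ComplexPoints S) ψ d' →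
      superBracket ℂ (transferOp ℂ 𝔑.q C t φ) (transferOp ℂ 𝔑.q C t' ψ) d.natAbs d'.natAbs =
        transferOp ℂ 𝔑.q C (t + t') (superBracket ℂ φ ψ d.natAbs d'.natAbs))
    (b : Module.Basis (Fin 16) ℂ (totalCohomology ℂ (ComplexPoints S)))
    (hb : ∀ I, b I ∈ LinearMap.range (ofDegree ℂ (ComplexPoints S) (deg4 I)))
    (hmul : ∀ I, Matrix.toLin b b ((mulMat I).map (Int.castRingHom ℂ)) = totalCup ℂ (ComplexPoints S) (b I))
    (Λ : Module.End ℂ (totalCohomology ℂ (ComplexPoints S)))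
    (hΛ : Matrix.toLin b b (lamMat.map (Int.castRingHom ℂ)) = Λ) (n : ℕ)
    (W : Submodule ℂ (totalCohomology ℂ (ComplexPoints (H.obj n))))
    (hgen : ∀ I : Fin 16, deg4 I ∈ ({1, 2, 3} : Set ℕ) →
      StableUnder n W (transferOp ℂ 𝔑.q C 1 (totalCup ℂ (ComplexPoints S) (b I))))
    (hf : StableUnder n W (transferOp ℂ 𝔑.q C (-1) Λ)) :
    ∀ k, 1 ≤ k → k ≤ n →
      (∀ w ∈ W, twoPt 𝔑 C LinearMap.id k n w ∈ W) ∧ ∀ I : Fin 16, I ≠ 0 → ∀ w ∈ W, twoPt 𝔑 C (polar b 0 I) k n w ∈ W :=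
  L1Hilb.stub_eval hcert 𝔑 hCg hC hLie b hb hmul Λ hΛ n W hgen hf

/-- (S-F) **Cyclic unit monomials span.**  A subspace `W ⊆ H*(S^[n])` containing `1_{S^[n]}`, stable under Lehn's
boundary operator `𝔡|ₙ = G₁(1_S, n) ∪ ·` and under all `τ_k(id)|ₙ`, `τ_k(b i ⊗ b_{i₀}^∨)|ₙ` (`1 ≤ k ≤ n`) for a
homogeneous basis `b` of `H*(S)` with `b i₀ = 1_S`, is everything. -/
theorem stub_span (𝔊 : ChernCharacterOperators hS H)
    {C : totalCohomology ℂ (ComplexPoints S) ⊗[ℂ] totalCohomology ℂ (ComplexPoints S)}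
    (hCg : C ∈ evenTensorSpan ℂ (coeffFamily S)) (hC : IsCasimir ℂ (poincarePairing hS) C)
    {ι : Type} [Fintype ι] [DecidableEq ι] (b : Module.Basis ι ℂ (totalCohomology ℂ (ComplexPoints S))) (i₀ : ι)
    (hb0 : b i₀ = unitCoeff S) (deg : ι → ℕ) (hb : ∀ i, b i ∈ LinearMap.range (ofDegree ℂ (ComplexPoints S) (deg i)))
    (n : ℕ) (W : Submodule ℂ (totalCohomology ℂ (ComplexPoints (H.obj n))))
    (h1 : ofDegree ℂ (ComplexPoints (H.obj n)) 0 (singularCohomology.one ℂ (ComplexPoints (H.obj n))) ∈ W)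
    (h𝔡 : ∀ w ∈ W, totalCup ℂ (ComplexPoints (H.obj n)) (𝔊.G 1 n (unitCoeff S)) w ∈ W)
    (hN : ∀ k, 1 ≤ k → k ≤ n → ∀ w ∈ W, twoPt 𝔊.toNakajimaOperators C LinearMap.id k n w ∈ W)
    (hP : ∀ k, 1 ≤ k → k ≤ n → ∀ i, i ≠ i₀ → ∀ w ∈ W, twoPt 𝔊.toNakajimaOperators C (polar b i₀ i) k n w ∈ W) :
    W = ⊤ := by
  sorry

/-! ### Composition (kernel-checked) -/

/-- A transfer operator preserves each `ℍₙ`; so `StableUnder n W (T)` reduces to the stability of `W` under `T|ₙ`. -/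
theorem stableUnder_transferOp (𝔑 : NakajimaOperators hS H)
    (C : totalCohomology ℂ (ComplexPoints S) ⊗[ℂ] totalCohomology ℂ (ComplexPoints S)) (t : ℤ)
    (φ : Module.End ℂ (totalCohomology ℂ (ComplexPoints S))) (n : ℕ)
    (W : Submodule ℂ (totalCohomology ℂ (ComplexPoints (H.obj n))))
    (h : ∀ w ∈ W, restrictFock ℂ (fockFamily H) (transferOp ℂ 𝔑.q C t φ) n w ∈ W) :
    StableUnder n W (transferOp ℂ 𝔑.q C t φ) :=
  ⟨fun y ↦ 𝔑.isHeisenberg.transferOp_apply_ofSummand_mem_range C t φ n y, h⟩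

/-- **L1-Hilb(n) for every `n`, from the six stubs.** -/
theorem lefschetzGenerationHilb_of_stubs (n : ℕ) : LefschetzGenerationHilb n := by
  intro A hA hS H 𝔊 C hCg hC α Λ_A hΛA
  unfold LefschetzGenerationHilbAt
  set W := opCupSpan ℂ (ComplexPoints (H.obj n)) (transferDual 𝔊.toNakajimaOperators C Λ_A n)
    (degreeClasses ℂ (ComplexPoints (H.obj n)) {0, 1, 2, 3}) with hW
  -- the model basis
  obtain ⟨b, hb0, hb, hmul, hlam⟩ := stub_model hA α Λ_A hΛA
  -- closure properties of `W` by definition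
  have hsub : degreeClasses ℂ (ComplexPoints (H.obj n)) {0, 1, 2, 3} ⊆ W := subset_opCupSpan
  have hcup : IsCupClosed W := isCupClosed_opCupSpan
  have hdual : transferDual 𝔊.toNakajimaOperators C Λ_A n ∈ stabilizerLie W := mem_stabilizerLie_opCupSpan
  -- generators: `T₁(m_{bI})|ₙ = 𝔊₀(b I)|ₙ = G₀(b I, n) ∪ ·` with `G₀(b I, n) ∈ H^{|I|} ⊆ W` for `|I| ≤ 3`
  have hgen : ∀ I : Fin 16, deg4 I ∈ ({1, 2, 3} : Set ℕ) →
      StableUnder n W (transferOp ℂ 𝔊.q C 1 (totalCup ℂ (ComplexPoints A.X) (b I))) := by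
    intro I hI
    refine stableUnder_transferOp 𝔊.toNakajimaOperators C 1 _ n W fun w hw ↦ ?_
    obtain ⟨y, hy⟩ := hb I
    rw [← hy, ← stub_lehnSuper 𝔊 hCg hC (deg4 I) y, ChernCharacterOperators.cupOperator, restrictFock_fiberwise]
    refine hcup _ ?_ w hw
    obtain ⟨d, hd⟩ := 𝔊.G_degree 0 n (deg4 I) y
    rw [← hd]
    refine hsub (ofDegree_mem_degreeClasses ?_ d)
    simp only [Set.mem_insert_iff, Set.mem_singleton_iff] at hI ⊢
    omega
  have hf : StableUnder n W (transferOp ℂ 𝔊.q C (-1) Λ_A) :=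
    stableUnder_transferOp 𝔊.toNakajimaOperators C (-1) Λ_A n W fun w hw ↦ hdual w hw
  -- (S-E): number operators and polarisations stabilise `W`
  have hNP := stub_eval stub_cert 𝔊.toNakajimaOperators hCg hC
    (fun t t' φ ψ d d' hφ hψ ↦ stub_superLie 𝔊.toNakajimaOperators hCg hC t t' hφ hψ) b hb hmul Λ_A hlam n W hgen hf
  -- `1 ∈ W` and `𝔡`-stability (`G₁(1_S, n) ∈ H² ⊆ W`, `W` cup-closed)
  have h1 : ofDegree ℂ (ComplexPoints (H.obj n)) 0 (singularCohomology.one ℂ (ComplexPoints (H.obj n))) ∈ W :=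
    hsub (ofDegree_mem_degreeClasses (by simp) _)
  have hG1 : 𝔊.G 1 n (unitCoeff A.X) ∈ W := by
    obtain ⟨d, hd⟩ := 𝔊.G_degree 1 n 0 (singularCohomology.one ℂ (ComplexPoints A.X))
    have hd' : ofDegree ℂ (ComplexPoints (H.obj n)) (0 + 2 * 1) d = 𝔊.G 1 n (unitCoeff A.X) := hd
    rw [← hd']
    exact hsub (ofDegree_mem_degreeClasses (by norm_num) d)
  have h𝔡 : ∀ w ∈ W, totalCup ℂ (ComplexPoints (H.obj n)) (𝔊.G 1 n (unitCoeff A.X)) w ∈ W :=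
    fun w hw ↦ hcup _ hG1 w hw
  -- (S-F)
  exact stub_span 𝔊 hCg hC b 0 hb0 deg4 hb n W h1 h𝔡 (fun k hk hkn ↦ (hNP k hk hkn).1)
    (fun k hk hkn i hi ↦ (hNP k hk hkn).2 i hi)

/-- **The crux BY NAME**: `…Theses.KummerFixedLocus.LefschetzGenerationHilb5` (= `LefschetzGenerationHilbW 5`, the W-form),
from the ∀-instance form at `n = 5`. -/
theorem LefschetzGenerationHilb5_of : Summit.Ventures.HodgeKum4.Theses.KummerFixedLocus.LefschetzGenerationHilb5 :=
  lefschetzGenerationHilbW_of_hilb (lefschetzGenerationHilb_of_stubs 5)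

end Summit.Ventures.HodgeKum4.Cruxes.LefschetzGenerationHilb5.V2p5

end
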